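import Mathlib.Analysis.InnerProductSpace.PiL2
import HarnessLib

/-!
# Run tops: the credit injection of the slot ledger

HONEST FRAMING. Part of the venture `Summits/Ventures/Crystal3D` (cell `crystal3d-full`), helper for the
crux `GenericWallFloor` (stmt-Ventures-19480) of `route-Ventures-StickyWulffConstant`, line `WallLedgerG`,
module M2c of the rigid-bicrystal rung (RIGID-RUNG-ARCH on the item).  Pure finite combinatorics; rung
credit only.

Fix a step vector `w ≠ 0` and finite sets `P ⊆ X ⊆ ℝ³`.  If `P` is RUN-CONVEX along `w` (whenever `p` and
`p + d·w`, `d ∈ ℕ`, are in `P`, so are the points in between) then the number of `w`-run tops of `P`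
(`p ∈ P`, `p + w ∉ P`) is at most the number of `w`-run tops of `X` lying on the forward `w`-ray of a point
of `P` (`card_runTops_le`): push each top of a `P`-run forward along `w` to the top of the `X`-run containing
it; run-convexity makes this injective.  In the ledger this designates, for every bond line of a grain
meeting its slab sample, an EMPTY slot of `X` on that line (outer ends with `w` pointing out of the cell,
inner "top sites" with `w = u*` the steepest slot), and different lines get different slots.
-/

noncomputable section

namespace Summit.Ventures.Crystal3D.Theorems

open Finset

variable {E : Type*} [NormedAddCommGroup E] [NormedSpace ℝ E]

/-- Points `p + k·w`, `k ∈ ℕ`, are pairwise distinct when `w ≠ 0`. -/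
theorem add_smul_injective (p w : E) (hw : w ≠ 0) :
    Function.Injective fun k : ℕ => p + (k : ℝ) • w := by
  intro k l h
  have h' : ((k : ℝ) - l) • w = 0 := by
    rw [sub_smul]; exact sub_eq_zero.2 (add_left_cancel h)
  rcases smul_eq_zero.1 h' with h1 | h1
  · exact_mod_cast sub_eq_zero.1 h1
  · exact absurd h1 hw

/-- Along a forward ray from a point of a finite set one eventually leaves the set. -/
theorem exists_add_succ_smul_notMem (X : Finset E) (p w : E) (hw : w ≠ 0) :
    ∃ m : ℕ, p + ((m + 1 : ℕ) : ℝ) • w ∉ X := by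
  by_contra h
  push Not at h
  let f : ℕ → (X : Set E) := fun k => ⟨p + ((k + 1 : ℕ) : ℝ) • w, h k⟩
  have hinj : Function.Injective f := by
    intro k l hkl
    have h1 : p + ((k + 1 : ℕ) : ℝ) • w = p + ((l + 1 : ℕ) : ℝ) • w := congrArg Subtype.val hkl
    have := add_smul_injective p w hw h1
    omega
  exact not_injective_infinite_finite f hinj

/-- The top of the `X`-run through `p` along `w`: the least `m` with `p + (m+1)·w ∉ X`. -/
theorem exists_runTop (X : Finset E) (p w : E) (hw : w ≠ 0) (hp : p ∈ X) :
    ∃ m : ℕ, p + ((m : ℕ) : ℝ) • w ∈ X ∧ p + ((m + 1 : ℕ) : ℝ) • w ∉ X ∧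
      ∀ k : ℕ, k ≤ m → p + ((k : ℕ) : ℝ) • w ∈ X := by
  classical
  obtain hex := exists_add_succ_smul_notMem X p w hw
  refine ⟨Nat.find hex, ?_, Nat.find_spec hex, ?_⟩
  · -- `p + m w ∈ X`: for `m = 0` this is `hp`, else minimality at `m - 1`
    rcases Nat.eq_zero_or_pos (Nat.find hex) with h0 | hpos
    · rw [h0]; simpa using hp
    · have hlt : Nat.find hex - 1 < Nat.find hex := by omega
      have := Nat.find_min hex hlt
      push Not at this
      have heq : Nat.find hex - 1 + 1 = Nat.find hex := by omega
      rwa [heq] at this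
  · intro k hk
    rcases Nat.eq_zero_or_pos k with h0 | hpos
    · rw [h0]; simpa using hp
    · have hlt : k - 1 < Nat.find hex := by omega
      have := Nat.find_min hex hlt
      push Not at this
      have heq : k - 1 + 1 = k := by omega
      rwa [heq] at this

open scoped Classical in
/-- **Run tops inject.**  `P ⊆ X` finite, `w ≠ 0`, `P` run-convex along `w`.  Then
`#{p ∈ P : p + w ∉ P} ≤ #{q ∈ X : q + w ∉ X ∧ q on the forward w-ray of a point of P}`. -/
theorem card_runTops_le (X P : Finset E) (w : E) (hw : w ≠ 0) (hPX : P ⊆ X)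
    (hconv : ∀ p ∈ P, ∀ d : ℕ, p + ((d : ℕ) : ℝ) • w ∈ P → ∀ k : ℕ, k ≤ d → p + ((k : ℕ) : ℝ) • w ∈ P) :
    (P.filter fun p => p + w ∉ P).card ≤
      (X.filter fun q => q + w ∉ X ∧ ∃ p ∈ P, ∃ m : ℕ, q = p + ((m : ℕ) : ℝ) • w).card := by
  classical
  -- the run-top map
  have key : ∀ p ∈ P.filter (fun p => p + w ∉ P), ∃ m : ℕ, p + ((m : ℕ) : ℝ) • w ∈ X ∧
      p + ((m + 1 : ℕ) : ℝ) • w ∉ X ∧ ∀ k : ℕ, k ≤ m → p + ((k : ℕ) : ℝ) • w ∈ X := by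
    intro p hp
    exact exists_runTop X p w hw (hPX (Finset.mem_filter.1 hp).1)
  choose! m hm using key
  refine Finset.card_le_card_of_injOn (fun p => p + ((m p : ℕ) : ℝ) • w) ?_ ?_
  · intro p hp
    obtain ⟨hX, hnot, -⟩ := hm p hp
    rw [Finset.mem_coe, Finset.mem_filter]
    refine ⟨hX, ?_, p, (Finset.mem_filter.1 hp).1, m p, rfl⟩
    have : p + ((m p : ℕ) : ℝ) • w + w = p + ((m p + 1 : ℕ) : ℝ) • w := by
      push_cast; rw [add_smul, one_smul, add_assoc]
    rw [this]; exact hnot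
  · intro p hp p' hp' heq
    simp only at heq
    -- WLOG compare m p and m p'
    by_contra hne
    have hpP : p ∈ P := (Finset.mem_filter.1 hp).1
    have hp'P : p' ∈ P := (Finset.mem_filter.1 hp').1
    have hptop : p + w ∉ P := (Finset.mem_filter.1 hp).2
    have hp'top : p' + w ∉ P := (Finset.mem_filter.1 hp').2
    rcases lt_trichotomy (m p) (m p') with hlt | hEq | hgt
    · -- from p + (m p) w = p' + (m p') w we get p = p' + (m p' - m p) w: p lies on the forward ray of p',
      -- and run-convexity of P from p' gives p' + w ∈ P, contradicting that p' is a top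
      have hd : p = p' + (((m p' - m p : ℕ) : ℕ) : ℝ) • w := by
        have h1 : ((m p' : ℕ) : ℝ) = ((m p' - m p : ℕ) : ℝ) + ((m p : ℕ) : ℝ) := by
          push_cast [Nat.cast_sub hlt.le]; ring
        have h2 : p' + ((m p' : ℕ) : ℝ) • w = (p' + ((m p' - m p : ℕ) : ℝ) • w) + ((m p : ℕ) : ℝ) • w := by
          rw [h1, add_smul, add_assoc]
        rw [h2] at heq
        exact add_right_cancel heq
      -- convexity of P along the ray from p' gives p' + 1•w ∈ P (since m p' - m p ≥ 1)
      have h1le : 1 ≤ m p' - m p := by omega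
      have hmem : p' + (((m p' - m p : ℕ) : ℕ) : ℝ) • w ∈ P := by rw [← hd]; exact hpP
      have := hconv p' hp'P (m p' - m p) hmem 1 h1le
      simp at this
      exact hp'top this
    · -- equal multiples: p = p'
      apply hne
      have : p + ((m p : ℕ) : ℝ) • w = p' + ((m p : ℕ) : ℝ) • w := by rw [heq, hEq]
      exact add_right_cancel this
    · have hd : p' = p + (((m p - m p' : ℕ) : ℕ) : ℝ) • w := by
        have h1 : ((m p : ℕ) : ℝ) = ((m p - m p' : ℕ) : ℝ) + ((m p' : ℕ) : ℝ) := by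
          push_cast [Nat.cast_sub hgt.le]; ring
        have h2 : p + ((m p : ℕ) : ℝ) • w = (p + ((m p - m p' : ℕ) : ℝ) • w) + ((m p' : ℕ) : ℝ) • w := by
          rw [h1, add_smul, add_assoc]
        rw [h2] at heq
        exact (add_right_cancel heq).symm
      have h1le : 1 ≤ m p - m p' := by omega
      have hmem : p + (((m p - m p' : ℕ) : ℕ) : ℝ) • w ∈ P := by rw [← hd]; exact hp'P
      have := hconv p hpP (m p - m p') hmem 1 h1le
      simp at this
      exact hptop this

end Summit.Ventures.Crystal3D.Theorems

end
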